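import Summits.CriticalPhenomena.PercolationContinuityZ3.Theorems.PercNearOneGluingNoHeavyLowerTailMajorityGluingTypeTableFixedMSupp
import HarnessLib

/-!
# The fixed-`M` programme in the kernel, template B (soundness): the family theorem with the ISO tangent rows
(lane prim-rate, constants-miner 1, gen 28; KERNEL-WINDOW.md §1–§4; CONVEX-BOOTSTRAP.md §5; RIGOROUS-CERTIFICATION.md §1)

Support file for the closed crux `NoHeavyLowerTail` (stmt-CriticalPhenomena-4575), majority-gluing line; continuation of
`…TypeTableFixedMGrid` (data, grid constants), `…TypeTableFixedMSupp` (support bounds, `cut_sound`) and `…TypeTableFixedM`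
(template A).  A LAW OF THE PROGRAMME at hub weights `0 < M ≤ 2^{−k/32}` in case `cs` (`FMLawB cs k M x`) satisfies template A's
hypotheses (22 `O`-free linear rows, normalisation, order, bands, 6 hub-pair + 12 relay-root van den Berg–Kahn rows) and the
power rows: hub ISO₃ `u_{0ab}^{c₃} ≤ M^{3−c₃}ρ₀π_{a¬b}π_{b¬a}`, relay ISO₃ `u_{abc}^{c₃} ≤ M^{3−c₃}ρ_aρ_bρ_c`, ISO₄
`U₄^{c₄} ≤ M^{4−c₄}Π_z(S_z+T_z)` (these three exactly as in `TypeTable.bottom_rows`), hub ISO₄ `u_{0abc}^{c₄} ≤ M^{4−c₄}ρ₀ρ_aρ_bρ_c`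
and ISO₅ `u_{01234}^{5/2} ≤ M^{5/2}Π_tρ_t` (the lane's THEOREM E in scale-free units).  This file proves the validity of every
checked tangent row for every such law (`trow_valid`, one lemma per power-row kind) and

  **`fixedMB_sound`: `checkFMB cs k rows y V = true` ⟹ `E(x) ≤ V` for every law with `FMLawB cs k M x`.**

A window certificate thereby becomes ONE `decide` on explicit data; the case cover and the chain over the grid are bookkeeping
on top.  No percolation, no sorries.  [cite: VandenbergHaggstromKahn2005, Thm. 1.3 (p. 6)]
-/

namespace Summit.CriticalPhenomena.PercolationContinuityZ3.Theorems

namespace HubOnly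
namespace TypeTable

open DType

noncomputable section

/-! ### Laws of the programme (template B) -/

/-- The hypotheses of the fixed-`M` programme with ISO rows on a law `x` in case `cs` at hub weights `0 < M ≤ 2^{−k/32}`. -/
structure FMLawB (cs : FMCase) (k : ℕ) (M : ℝ) (x : DType → ℝ) : Prop extends FMLaw cs x where
  /-- positive hub weight -/
  Mpos : 0 < M
  /-- the grid bound -/
  Mle : M ≤ (2 : ℝ) ^ (-(k : ℝ) / 32)
  /-- hub ISO₃ rows -/
  isoH : ∀ a ∈ [1, 2, 3, 4], ∀ b ∈ [1, 2, 3, 4], a < b →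
    uS [0, a, b] x ^ ((3 + Real.sqrt 3) / 2) ≤ M ^ (3 - (3 + Real.sqrt 3) / 2) * Rho0 a b x * Pim a b x * Pim b a x
  /-- relay ISO₃ rows -/
  isoR : ∀ a ∈ [1, 2, 3, 4], ∀ b ∈ [1, 2, 3, 4], ∀ c ∈ [1, 2, 3, 4], a < b → b < c →
    uS [a, b, c] x ^ ((3 + Real.sqrt 3) / 2) ≤
      M ^ (3 - (3 + Real.sqrt 3) / 2) * lin (fun τ => ind (τ.rho [a, b, c] a)) x *
        lin (fun τ => ind (τ.rho [a, b, c] b)) x * lin (fun τ => ind (τ.rho [a, b, c] c)) x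
  /-- the ISO₄ row of `{1,2,3,4}` in profile form -/
  iso4 : uS [1, 2, 3, 4] x ^ ((3 + Real.sqrt (11 / 3)) / 2) ≤
    M ^ (4 - (3 + Real.sqrt (11 / 3)) / 2) * (Sm 1 x + Tm 1 x) * (Sm 2 x + Tm 2 x) * (Sm 3 x + Tm 3 x) * (Sm 4 x + Tm 4 x)
  /-- hub ISO₄ rows -/
  isoH4 : ∀ a ∈ [1, 2, 3, 4], ∀ b ∈ [1, 2, 3, 4], ∀ c ∈ [1, 2, 3, 4], a < b → b < c →
    uS [0, a, b, c] x ^ ((3 + Real.sqrt (11 / 3)) / 2) ≤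
      M ^ (4 - (3 + Real.sqrt (11 / 3)) / 2) * lin (fun τ => ind (τ.rho [0, a, b, c] 0)) x *
        lin (fun τ => ind (τ.rho [0, a, b, c] a)) x * lin (fun τ => ind (τ.rho [0, a, b, c] b)) x *
        lin (fun τ => ind (τ.rho [0, a, b, c] c)) x
  /-- the ISO₅ row (scale-free form of `μ(u)^5 ≤ Π_t μ(ρ_t)^2`) -/
  iso5 : uS [0, 1, 2, 3, 4] x ^ ((5 : ℝ) / 2) ≤
    M ^ ((5 : ℝ) / 2) * lin (fun τ => ind (τ.rho [0, 1, 2, 3, 4] 0)) x * lin (fun τ => ind (τ.rho [0, 1, 2, 3, 4] 1)) x *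
      lin (fun τ => ind (τ.rho [0, 1, 2, 3, 4] 2)) x * lin (fun τ => ind (τ.rho [0, 1, 2, 3, 4] 3)) x *
      lin (fun τ => ind (τ.rho [0, 1, 2, 3, 4] 4)) x

/-! ### Validity of the tangent rows -/

variable {cs : FMCase} {k : ℕ} {M : ℝ} {x : DType → ℝ}

/-- Hub ISO₃ cut validity. -/
theorem tan_hub3 (L : FMLawB cs k M x) {a b : ℕ} (ha : a ∈ [1, 2, 3, 4]) (hb : b ∈ [1, 2, 3, 4]) (hab : a < b)
    {i j : ℤ} {N G1 G2 : ℕ} {H : ℚ} (hN : 0 < N)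
    (c1 : (PKind.hub3 a b).Cu k * powUp TH3L TH3U (i + j) * (1 - 2 * QL3) ≤ H / N)
    (c2 : (PKind.hub3 a b).Cu k * QU3 * powUp TH3L TH3U (i + j) * powUp ETAL ETAU (-i) ≤ (G1 : ℚ) / N)
    (c3 : (PKind.hub3 a b).Cu k * QU3 * powUp TH3L TH3U (i + j) * powUp ETAL ETAU (-j) ≤ (G2 : ℚ) / N) :
    (N : ℝ) * uS [0, a, b] x + -(G1 : ℝ) * Pim a b x + -(G2 : ℝ) * Pim b a x ≤ H := by
  have hx := L.nonneg
  obtain ⟨hB2, hB3, hB4⟩ := L.budgets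
  obtain ⟨hc, hql, hqu, hq2, hn⟩ := c3_facts
  have hK : 0 ≤ M ^ (3 - (3 + Real.sqrt 3) / 2) := Real.rpow_nonneg L.Mpos.le _
  have hC : (M ^ (3 - (3 + Real.sqrt 3) / 2) * 1) ^ ((3 + Real.sqrt 3) / 2)⁻¹ ≤
      (((PKind.hub3 a b).Cu k : ℚ) : ℝ) := by
    rw [mul_one]
    have h := scaled_const_le (n := 3) L.Mpos L.Mle hc hn (by decide +kernel) theta3_bounds.1 theta3_bounds.2 (k := k)
    simp only [PKind.Cu]
    exact_mod_cast h
  exact cut_sound (lin_ind_nonneg _ hx) hK (lin_ind_nonneg _ hx)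
    (rho0_le_one x hx L.norm hB2 hB3 hB4 a ha b hb (Nat.ne_of_lt hab)) (lin_ind_nonneg _ hx) (lin_ind_nonneg _ hx)
    hc hql hqu hq2 (L.isoH a ha b hb hab) hC (supp_pow_le (by decide +kernel) theta3_bounds.1 theta3_bounds.2 i j)
    hN c1 c2 c3

/-- Relay ISO₃ cut validity (support `ρ_f` bounded by `2`). -/
theorem tan_rel3 (L : FMLawB cs k M x) {a b c f : ℕ} (ha : a ∈ [1, 2, 3, 4]) (hb : b ∈ [1, 2, 3, 4])
    (hc' : c ∈ [1, 2, 3, 4]) (hab : a < b) (hbc : b < c) (hf : f = a ∨ f = b ∨ f = c)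
    {i j : ℤ} {N G1 G2 : ℕ} {H : ℚ} (hN : 0 < N)
    (c1 : (PKind.rel3 a b c f).Cu k * powUp TH3L TH3U (i + j) * (1 - 2 * QL3) ≤ H / N)
    (c2 : (PKind.rel3 a b c f).Cu k * QU3 * powUp TH3L TH3U (i + j) * powUp ETAL ETAU (-i) ≤ (G1 : ℚ) / N)
    (c3 : (PKind.rel3 a b c f).Cu k * QU3 * powUp TH3L TH3U (i + j) * powUp ETAL ETAU (-j) ≤ (G2 : ℚ) / N) :
    (N : ℝ) * uS [a, b, c] x + -(G1 : ℝ) * lin (fun τ => ind (τ.rho [a, b, c] (others3 a b c f).1)) x +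
      -(G2 : ℝ) * lin (fun τ => ind (τ.rho [a, b, c] (others3 a b c f).2)) x ≤ H := by
  have hx := L.nonneg
  obtain ⟨hB2, hB3, hB4⟩ := L.budgets
  obtain ⟨hc, hql, hqu, hq2, hn⟩ := c3_facts
  have hK : 0 ≤ M ^ (3 - (3 + Real.sqrt 3) / 2) := Real.rpow_nonneg L.Mpos.le _
  have hC : (M ^ (3 - (3 + Real.sqrt 3) / 2) * 2) ^ ((3 + Real.sqrt 3) / 2)⁻¹ ≤
      (((PKind.rel3 a b c f).Cu k : ℚ) : ℝ) := by
    rw [Real.mul_rpow hK (by norm_num)]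
    have h := scaled_const_le (n := 3) L.Mpos L.Mle hc hn (by decide +kernel) theta3_bounds.1 theta3_bounds.2 (k := k)
    have h2 := (R_pow_le theta3_bounds.2).1
    simp only [PKind.Cu]
    push_cast at h h2 ⊢
    exact mul_le_mul h h2 (by positivity) ((by positivity : (0:ℝ) ≤ (M ^ ((3:ℝ) - (3 + Real.sqrt 3) / 2)) ^
      ((3 + Real.sqrt 3) / 2)⁻¹).trans (by exact_mod_cast h))
  have hf' : f ∈ [1, 2, 3, 4] := by rcases hf with rfl | rfl | rfl <;> assumption
  set ρ : ℕ → ℝ := fun t => lin (fun τ => ind (τ.rho [a, b, c] t)) x with hρ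
  have ρ0 : ∀ t, 0 ≤ ρ t := fun t => lin_ind_nonneg _ hx
  have row0 := L.isoR a ha b hb c hc' hab hbc
  have hρf : ρ f ≤ 2 := by
    rcases hf with rfl | rfl | rfl
    · exact rho3_le_two x hx L.norm hB2 hB3 hB4 ha hb hc' hab hbc ha hb (Or.inl rfl) (Or.inr (Or.inl rfl)) (by omega)
    · exact rho3_le_two x hx L.norm hB2 hB3 hB4 ha hb hc' hab hbc hb ha (Or.inr (Or.inl rfl)) (Or.inl rfl) (by omega)
    · exact rho3_le_two x hx L.norm hB2 hB3 hB4 ha hb hc' hab hbc hc' ha (Or.inr (Or.inr rfl)) (Or.inl rfl) (by omega)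
  have row : uS [a, b, c] x ^ ((3 + Real.sqrt 3) / 2) ≤ M ^ (3 - (3 + Real.sqrt 3) / 2) * ρ f *
      ρ (others3 a b c f).1 * ρ (others3 a b c f).2 := by
    have hab' : a ≠ b := Nat.ne_of_lt hab
    have hbc' : b ≠ c := Nat.ne_of_lt hbc
    have hac' : a ≠ c := Nat.ne_of_lt (hab.trans hbc)
    rcases hf with rfl | rfl | rfl
    · simpa [others3, hρ] using row0
    · have e : others3 a f c f = (a, c) := by simp [others3, hab'.symm]
      rw [e]; calc _ ≤ _ := row0
        _ = _ := by simp only [hρ]; ring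
    · have e : others3 a b f f = (a, b) := by simp [others3, hac'.symm, hbc'.symm]
      rw [e]; calc _ ≤ _ := row0
        _ = _ := by simp only [hρ]; ring
  exact cut_sound (lin_ind_nonneg _ hx) hK (ρ0 f) hρf (ρ0 _) (ρ0 _) hc hql hqu hq2 row hC
    (supp_pow_le (by decide +kernel) theta3_bounds.1 theta3_bounds.2 i j) hN c1 c2 c3

/-- ISO₄ cut validity (two factors `S_z+T_z` bounded by `2`). -/
theorem tan_iso4 (L : FMLawB cs k M x) {a b : ℕ} (ha : a ∈ [1, 2, 3, 4]) (hb : b ∈ [1, 2, 3, 4]) (hab : a < b)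
    {i j : ℤ} {N G1 G2 : ℕ} {H : ℚ} (hN : 0 < N)
    (c1 : (PKind.iso4 a b).Cu k * powUp TH4L TH4U (i + j) * (1 - 2 * QL4) ≤ H / N)
    (c2 : (PKind.iso4 a b).Cu k * QU4 * powUp TH4L TH4U (i + j) * powUp ETAL ETAU (-i) ≤ (G1 : ℚ) / N)
    (c3 : (PKind.iso4 a b).Cu k * QU4 * powUp TH4L TH4U (i + j) * powUp ETAL ETAU (-j) ≤ (G2 : ℚ) / N) :
    (N : ℝ) * uS [1, 2, 3, 4] x + -(G1 : ℝ) * (Sm a x + Tm a x) + -(G2 : ℝ) * (Sm b x + Tm b x) ≤ H := by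
  have hx := L.nonneg
  obtain ⟨hB2, hB3, hB4⟩ := L.budgets
  obtain ⟨hc, hql, hqu, hq2, hn⟩ := c4_facts
  have hK : 0 ≤ M ^ (4 - (3 + Real.sqrt (11 / 3)) / 2) := Real.rpow_nonneg L.Mpos.le _
  have hC : (M ^ (4 - (3 + Real.sqrt (11 / 3)) / 2) * 4) ^ ((3 + Real.sqrt (11 / 3)) / 2)⁻¹ ≤
      (((PKind.iso4 a b).Cu k : ℚ) : ℝ) := by
    rw [Real.mul_rpow hK (by norm_num)]
    have h := scaled_const_le (n := 4) L.Mpos L.Mle hc hn (by decide +kernel) theta4_bounds.1 theta4_bounds.2 (k := k)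
    have h2 := (R_pow_le theta4_bounds.2).2
    simp only [PKind.Cu]
    push_cast at h h2 ⊢
    exact mul_le_mul h h2 (by positivity) ((by positivity : (0:ℝ) ≤ (M ^ ((4:ℝ) - (3 + Real.sqrt (11 / 3)) / 2)) ^
      ((3 + Real.sqrt (11 / 3)) / 2)⁻¹).trans (by exact_mod_cast h))
  set st : ℕ → ℝ := fun z => Sm z x + Tm z x with hst
  have st0 : ∀ z ∈ [1, 2, 3, 4], 0 ≤ st z := fun z _ => add_nonneg (lin_ind_nonneg _ hx) (lin_ind_nonneg _ hx)
  have st2 := st_le_two x hx L.norm hB2 hB3 hB4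
  have hπ := prod4_le st st0 st2 ha hb hab
  have row : uS [1, 2, 3, 4] x ^ ((3 + Real.sqrt (11 / 3)) / 2) ≤
      M ^ (4 - (3 + Real.sqrt (11 / 3)) / 2) * 4 * st a * st b := by
    calc _ ≤ M ^ (4 - (3 + Real.sqrt (11 / 3)) / 2) * (st 1 * st 2 * st 3 * st 4) := by
          have h := L.iso4; simp only [hst]; linarith [h]
      _ ≤ M ^ (4 - (3 + Real.sqrt (11 / 3)) / 2) * (4 * st a * st b) := mul_le_mul_of_nonneg_left hπ hK
      _ = _ := by ring
  exact cut_sound (lin_ind_nonneg _ hx) hK (by norm_num) le_rfl (st0 a ha) (st0 b hb) hc hql hqu hq2 row hC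
    (supp_pow_le (by decide +kernel) theta4_bounds.1 theta4_bounds.2 i j) hN c1 c2 c3

/-- Hub ISO₄ cut validity (`ρ₀`, `ρ_f` bounded by `1`). -/
theorem tan_hub4 (L : FMLawB cs k M x) {a b c f : ℕ} (ha : a ∈ [1, 2, 3, 4]) (hb : b ∈ [1, 2, 3, 4])
    (hc' : c ∈ [1, 2, 3, 4]) (hab : a < b) (hbc : b < c) (hf : f = a ∨ f = b ∨ f = c)
    {i j : ℤ} {N G1 G2 : ℕ} {H : ℚ} (hN : 0 < N)
    (c1 : (PKind.hub4 a b c f).Cu k * powUp TH4L TH4U (i + j) * (1 - 2 * QL4) ≤ H / N)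
    (c2 : (PKind.hub4 a b c f).Cu k * QU4 * powUp TH4L TH4U (i + j) * powUp ETAL ETAU (-i) ≤ (G1 : ℚ) / N)
    (c3 : (PKind.hub4 a b c f).Cu k * QU4 * powUp TH4L TH4U (i + j) * powUp ETAL ETAU (-j) ≤ (G2 : ℚ) / N) :
    (N : ℝ) * uS [0, a, b, c] x + -(G1 : ℝ) * lin (fun τ => ind (τ.rho [0, a, b, c] (others3 a b c f).1)) x +
      -(G2 : ℝ) * lin (fun τ => ind (τ.rho [0, a, b, c] (others3 a b c f).2)) x ≤ H := by
  have hx := L.nonneg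
  obtain ⟨hB2, hB3, hB4⟩ := L.budgets
  obtain ⟨hc, hql, hqu, hq2, hn⟩ := c4_facts
  have hK : 0 ≤ M ^ (4 - (3 + Real.sqrt (11 / 3)) / 2) := Real.rpow_nonneg L.Mpos.le _
  have hC : (M ^ (4 - (3 + Real.sqrt (11 / 3)) / 2) * 1) ^ ((3 + Real.sqrt (11 / 3)) / 2)⁻¹ ≤
      (((PKind.hub4 a b c f).Cu k : ℚ) : ℝ) := by
    rw [mul_one]
    have h := scaled_const_le (n := 4) L.Mpos L.Mle hc hn (by decide +kernel) theta4_bounds.1 theta4_bounds.2 (k := k)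
    simp only [PKind.Cu]
    exact_mod_cast h
  have hS : [0, a, b, c] ∈ [[0, 1, 2, 3], [0, 1, 2, 4], [0, 1, 3, 4], [0, 2, 3, 4], [0, 1, 2, 3, 4]] := by
    simp only [List.mem_cons, List.not_mem_nil, or_false] at ha hb hc'
    rcases ha with rfl | rfl | rfl | rfl <;> rcases hb with rfl | rfl | rfl | rfl <;> rcases hc' with rfl | rfl | rfl | rfl <;>
      first | omega | simp
  obtain ⟨hρt, hρ0⟩ := rho_hubset_le_one x hx L.norm hB2 hB3 hB4 hS
  set ρ : ℕ → ℝ := fun t => lin (fun τ => ind (τ.rho [0, a, b, c] t)) x with hρ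
  have ρ0 : ∀ t, 0 ≤ ρ t := fun t => lin_ind_nonneg _ hx
  have hf' : f ∈ [1, 2, 3, 4] := by rcases hf with rfl | rfl | rfl <;> assumption
  have hfS : f ∈ [0, a, b, c] := by rcases hf with rfl | rfl | rfl <;> simp
  have hF : ρ 0 * ρ f ≤ 1 := by
    have h1 : ρ 0 ≤ 1 := hρ0
    have h2 : ρ f ≤ 1 := hρt f hf' hfS
    calc ρ 0 * ρ f ≤ 1 * 1 := mul_le_mul h1 h2 (ρ0 f) (by norm_num)
      _ = 1 := by norm_num
  have row0 := L.isoH4 a ha b hb c hc' hab hbc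
  have row : uS [0, a, b, c] x ^ ((3 + Real.sqrt (11 / 3)) / 2) ≤ M ^ (4 - (3 + Real.sqrt (11 / 3)) / 2) * (ρ 0 * ρ f) *
      ρ (others3 a b c f).1 * ρ (others3 a b c f).2 := by
    have hab' : a ≠ b := Nat.ne_of_lt hab
    have hbc' : b ≠ c := Nat.ne_of_lt hbc
    have hac' : a ≠ c := Nat.ne_of_lt (hab.trans hbc)
    rcases hf with rfl | rfl | rfl
    · have e : others3 f b c f = (b, c) := by simp [others3]
      rw [e]; calc _ ≤ _ := row0
        _ = _ := by simp only [hρ]; ring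
    · have e : others3 a f c f = (a, c) := by simp [others3, hab'.symm]
      rw [e]; calc _ ≤ _ := row0
        _ = _ := by simp only [hρ]; ring
    · have e : others3 a b f f = (a, b) := by simp [others3, hac'.symm, hbc'.symm]
      rw [e]; calc _ ≤ _ := row0
        _ = _ := by simp only [hρ]; ring
  exact cut_sound (lin_ind_nonneg _ hx) hK (mul_nonneg (ρ0 0) (ρ0 f)) hF (ρ0 _) (ρ0 _) hc hql hqu hq2 row hC
    (supp_pow_le (by decide +kernel) theta4_bounds.1 theta4_bounds.2 i j) hN c1 c2 c3

/-- ISO₅ cut validity (`ρ₀` and the two other relay supports bounded by `1`). -/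
theorem tan_iso5 (L : FMLawB cs k M x) {a b : ℕ} (ha : a ∈ [1, 2, 3, 4]) (hb : b ∈ [1, 2, 3, 4]) (hab : a < b)
    {i j : ℤ} {N G1 G2 : ℕ} {H : ℚ} (hN : 0 < N)
    (c1 : (PKind.iso5 a b).Cu k * powUp LAML LAMU (i + j) * (1 - 2 * (2 / 5 : ℚ)) ≤ H / N)
    (c2 : (PKind.iso5 a b).Cu k * (2 / 5 : ℚ) * powUp LAML LAMU (i + j) * powUp ETAL ETAU (-i) ≤ (G1 : ℚ) / N)
    (c3 : (PKind.iso5 a b).Cu k * (2 / 5 : ℚ) * powUp LAML LAMU (i + j) * powUp ETAL ETAU (-j) ≤ (G2 : ℚ) / N) :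
    (N : ℝ) * uS [0, 1, 2, 3, 4] x + -(G1 : ℝ) * lin (fun τ => ind (τ.rho [0, 1, 2, 3, 4] a)) x +
      -(G2 : ℝ) * lin (fun τ => ind (τ.rho [0, 1, 2, 3, 4] b)) x ≤ H := by
  have hx := L.nonneg
  obtain ⟨hB2, hB3, hB4⟩ := L.budgets
  obtain ⟨hc, hql, hqu, hq2⟩ := c5_facts
  have hK : 0 ≤ M ^ ((5 : ℝ) / 2) := Real.rpow_nonneg L.Mpos.le _
  have hC : (M ^ ((5 : ℝ) / 2) * 1) ^ ((5 : ℝ) / 2)⁻¹ ≤ (((PKind.iso5 a b).Cu k : ℚ) : ℝ) := by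
    rw [mul_one]; simp only [PKind.Cu]; exact iso5_const_le L.Mpos L.Mle
  obtain ⟨hρt, hρ0⟩ := rho_hubset_le_one x hx L.norm hB2 hB3 hB4 (S := [0, 1, 2, 3, 4]) (by simp)
  set ρ : ℕ → ℝ := fun t => lin (fun τ => ind (τ.rho [0, 1, 2, 3, 4] t)) x with hρ
  have ρ0 : ∀ t, 0 ≤ ρ t := fun t => lin_ind_nonneg _ hx
  have ρ1 : ∀ t ∈ [1, 2, 3, 4], ρ t ≤ 1 := fun t ht => hρt t ht (by
    simp only [List.mem_cons, List.not_mem_nil, or_false] at ht; rcases ht with rfl | rfl | rfl | rfl <;> simp)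
  have P3 : ∀ {p q r : ℝ}, 0 ≤ p → 0 ≤ q → 0 ≤ r → p ≤ 1 → q ≤ 1 → r ≤ 1 → p * q * r ≤ 1 := by
    intro p q r hp hq hr hp1 hq1 hr1
    have h1 : p * q ≤ 1 * 1 := mul_le_mul hp1 hq1 hq (by norm_num)
    calc p * q * r ≤ 1 * 1 * 1 := mul_le_mul (by linarith) hr1 hr (by norm_num)
      _ = 1 := by norm_num
  have row0 := L.iso5
  have k0 := hρ0; have k1 := ρ1 1 (by simp); have k2 := ρ1 2 (by simp); have k3 := ρ1 3 (by simp); have k4 := ρ1 4 (by simp)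
  simp only [List.mem_cons, List.not_mem_nil, or_false] at ha hb
  -- the bounded factor F (product of ρ₀ and the two relays other than a, b) and the rearranged row
  have key : ∃ F : ℝ, 0 ≤ F ∧ F ≤ 1 ∧
      uS [0, 1, 2, 3, 4] x ^ ((5 : ℝ) / 2) ≤ M ^ ((5 : ℝ) / 2) * F * ρ a * ρ b := by
    rcases ha with rfl | rfl | rfl | rfl <;> rcases hb with rfl | rfl | rfl | rfl <;> (try omega)
    · exact ⟨ρ 0 * ρ 3 * ρ 4, mul_nonneg (mul_nonneg (ρ0 0) (ρ0 3)) (ρ0 4), P3 (ρ0 0) (ρ0 3) (ρ0 4) k0 k3 k4, by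
        calc _ ≤ _ := row0
          _ = _ := by simp only [hρ]; ring⟩
    · exact ⟨ρ 0 * ρ 2 * ρ 4, mul_nonneg (mul_nonneg (ρ0 0) (ρ0 2)) (ρ0 4), P3 (ρ0 0) (ρ0 2) (ρ0 4) k0 k2 k4, by
        calc _ ≤ _ := row0
          _ = _ := by simp only [hρ]; ring⟩
    · exact ⟨ρ 0 * ρ 2 * ρ 3, mul_nonneg (mul_nonneg (ρ0 0) (ρ0 2)) (ρ0 3), P3 (ρ0 0) (ρ0 2) (ρ0 3) k0 k2 k3, by
        calc _ ≤ _ := row0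
          _ = _ := by simp only [hρ]; ring⟩
    · exact ⟨ρ 0 * ρ 1 * ρ 4, mul_nonneg (mul_nonneg (ρ0 0) (ρ0 1)) (ρ0 4), P3 (ρ0 0) (ρ0 1) (ρ0 4) k0 k1 k4, by
        calc _ ≤ _ := row0
          _ = _ := by simp only [hρ]; ring⟩
    · exact ⟨ρ 0 * ρ 1 * ρ 3, mul_nonneg (mul_nonneg (ρ0 0) (ρ0 1)) (ρ0 3), P3 (ρ0 0) (ρ0 1) (ρ0 3) k0 k1 k3, by
        calc _ ≤ _ := row0
          _ = _ := by simp only [hρ]; ring⟩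
    · exact ⟨ρ 0 * ρ 1 * ρ 2, mul_nonneg (mul_nonneg (ρ0 0) (ρ0 1)) (ρ0 2), P3 (ρ0 0) (ρ0 1) (ρ0 2) k0 k1 k2, by
        calc _ ≤ _ := row0
          _ = _ := by simp only [hρ]; ring⟩
  obtain ⟨F, hF0, hF1, row⟩ := key
  exact cut_sound (lin_ind_nonneg _ hx) hK hF0 hF1 (ρ0 _) (ρ0 _) hc hql hqu hq2 row hC
    (supp_pow_le (by decide +kernel) lam_bounds.1 lam_bounds.2 i j) hN c1 c2 c3

/-- **Tangent-row validity.**  Every tangent row accepted by `TRow.ok k` holds for every law of the programme. -/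
theorem trow_valid (L : FMLawB cs k M x) (r : TRow) (hr : r.ok k = true) : lin r.toRow.φ x ≤ (r.toRow.b : ℝ) := by
  obtain ⟨κ, i, j, N, G1, G2, H⟩ := r
  simp only [TRow.ok, Bool.and_eq_true, decide_eq_true_eq] at hr
  obtain ⟨⟨⟨⟨hk, hN⟩, c1⟩, c2⟩, c3⟩ := hr
  cases κ with
  | hub3 a b =>
    simp only [PKind.ok, Bool.and_eq_true, decide_eq_true_eq] at hk
    obtain ⟨⟨ha, hb⟩, hab⟩ := hk
    simp only [PKind.QL, PKind.QU, PKind.Pu] at c1 c2 c3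
    have h := tan_hub3 L ha hb hab hN c1 c2 c3
    simp only [TRow.toRow, lin_combo, List.map_cons, List.map_nil, List.sum_cons, List.sum_nil, PKind.uφ,
      PKind.s1φ, PKind.s2φ, uS, Pim] at h ⊢
    push_cast at h ⊢
    linarith
  | rel3 a b c f =>
    simp only [PKind.ok, Bool.and_eq_true, Bool.or_eq_true, decide_eq_true_eq] at hk
    obtain ⟨⟨⟨⟨⟨ha, hb⟩, hc⟩, hab⟩, hbc⟩, hf⟩ := hk
    simp only [PKind.QL, PKind.QU, PKind.Pu] at c1 c2 c3
    have h := tan_rel3 L ha hb hc hab hbc (or_assoc.mp hf) hN c1 c2 c3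
    simp only [TRow.toRow, lin_combo, List.map_cons, List.map_nil, List.sum_cons, List.sum_nil, PKind.uφ,
      PKind.s1φ, PKind.s2φ, uS] at h ⊢
    push_cast at h ⊢
    linarith
  | iso4 a b =>
    simp only [PKind.ok, Bool.and_eq_true, decide_eq_true_eq] at hk
    obtain ⟨⟨ha, hb⟩, hab⟩ := hk
    simp only [PKind.QL, PKind.QU, PKind.Pu] at c1 c2 c3
    have h := tan_iso4 L ha hb hab hN c1 c2 c3
    simp only [TRow.toRow, lin_combo, List.map_cons, List.map_nil, List.sum_cons, List.sum_nil, PKind.uφ,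
      PKind.s1φ, PKind.s2φ, uS, Sm, Tm] at h ⊢
    push_cast at h ⊢
    linarith
  | hub4 a b c f =>
    simp only [PKind.ok, Bool.and_eq_true, Bool.or_eq_true, decide_eq_true_eq] at hk
    obtain ⟨⟨⟨⟨⟨ha, hb⟩, hc⟩, hab⟩, hbc⟩, hf⟩ := hk
    simp only [PKind.QL, PKind.QU, PKind.Pu] at c1 c2 c3
    have h := tan_hub4 L ha hb hc hab hbc (or_assoc.mp hf) hN c1 c2 c3
    simp only [TRow.toRow, lin_combo, List.map_cons, List.map_nil, List.sum_cons, List.sum_nil, PKind.uφ,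
      PKind.s1φ, PKind.s2φ, uS] at h ⊢
    push_cast at h ⊢
    linarith
  | iso5 a b =>
    simp only [PKind.ok, Bool.and_eq_true, decide_eq_true_eq] at hk
    obtain ⟨⟨ha, hb⟩, hab⟩ := hk
    simp only [PKind.QL, PKind.QU, PKind.Pu] at c1 c2 c3
    have h := tan_iso5 L ha hb hab hN c1 c2 c3
    simp only [TRow.toRow, lin_combo, List.map_cons, List.map_nil, List.sum_cons, List.sum_nil, PKind.uφ,
      PKind.s1φ, PKind.s2φ, uS] at h ⊢
    push_cast at h ⊢
    linarith

/-- **THE FAMILY THEOREM (template B).**  If `checkFMB cs k rows y V = true` then `E(x) ≤ V` for every law of the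
fixed-`M` programme in case `cs` at hub weights `0 < M ≤ 2^{−k/32}`. -/
theorem fixedMB_sound {ks : List BRow} {y : List ℚ} {V : ℚ} (hchk : checkFMB cs k ks y V = true)
    (L : FMLawB cs k M x) : E x ≤ (V : ℝ) := by
  simp only [checkFMB, Bool.and_eq_true, List.all_eq_true, decide_eq_true_eq] at hchk
  obtain ⟨⟨hks, hV⟩, hcert⟩ := hchk
  by_cases hpos : ∀ z ∈ [1, 2, 3, 4], 0 < Tm z x
  · have hrows : ∀ r ∈ ks.map BRow.toRow, lin r.φ x ≤ (r.b : ℝ) := by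
      intro r hr
      obtain ⟨br, hbr, rfl⟩ := List.mem_map.mp hr
      obtain ⟨hB2, hB3, hB4⟩ := L.budgets
      cases br with
      | base r => exact row_valid L.toFMLaw hpos r (hks _ hbr)
      | junk z =>
        have hz := hks _ hbr
        simp only [BRow.ok, decide_eq_true_eq] at hz
        simpa [BRow.toRow] using junk_row_valid x L.nonneg hB2 hB3 hB4 hz
      | tan r => exact trow_valid L r (hks _ hbr)
    obtain ⟨hB2, hB3, hB4⟩ := L.budgets
    exact lpCert_sound hcert x L.nonneg (nonInert_le_one x L.nonneg L.norm hB2 hB3 hB4) hrows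
  · push Not at hpos
    obtain ⟨z, hz, hTz⟩ := hpos
    have hE := L.E_le_Tm z hz
    have hV' : (0 : ℝ) ≤ (V : ℝ) := by exact_mod_cast hV
    linarith

end

/-! ### Smoke tests of the data path -/

/-- A hub ISO₃ cut at `M ≤ 2^{−5}` (`k = 160`), support point `(2^{−3}, 2^{−3})`, as emitted by the lane's generator
(census/g28/fmb/fmbdata.py: `H/N, G/N` = the certified tangent data rounded up), passes the rational check. -/
theorem trow_ok_smoke :
    TRow.ok 160 ⟨.hub3 1 2, -96, -96, 10 ^ 9, 230349590, 230349590, 10539225183221 / 10 ^ 6⟩ = true := by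
  decide +kernel

/-- Template A's smoke programme plus a junk row and the cut above with multipliers `0`: accepted with the same value `V = 6`. -/
theorem checkFMB_smoke :
    checkFMB ⟨[1, 2, 3, 4], fun _ => false⟩ 160
      [.base (.linfree 0), .base .norm, .base (.order 1 2), .base (.poorBand 1), .base (.relay 1 2),
        .base (.pair 1 2 2 2 1 1), .junk 3, .tan ⟨.hub3 1 2, -96, -96, 10 ^ 9, 230349590, 230349590, 10539225183221 / 10 ^ 6⟩]
      [0, 1, 0, 0, 0, 0, 0, 0] 6 = true := by
  decide +kernel

end TypeTable
end HubOnly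

end Summit.CriticalPhenomena.PercolationContinuityZ3.Theorems
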